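import Summits.QuantumAdvantage.QuantumAdvantage.Theses.CubicForrelation
import Literature.Computability.QuantumComplexity.SignedCubicForrelation
import Summits.QuantumAdvantage.QuantumAdvantage.Theorems.CubicForrelationSignedExactCubicForrelationNotPrBPPStubFrameLock
import Summits.QuantumAdvantage.QuantumAdvantage.Theorems.CubicForrelationSignedExactCubicForrelationNotPrBPPStubNoTrapTemplateLemmas

/-!
# Crux `CubicForrelation.SignedExactCubicForrelationNotPrBPP` (stmt-QuantumAdvantage-13932) — stub `stub_mpairClosed`

Stub `stub_mpairClosed` of line `dual-pingpong-frame` (GROW reshape): **M-pairs of an exact cubic pair are closed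
orthogonal pairs.** Let `a`, `b` have algebraic degree `≤ 3` with `Φ(a, b) = ±1` and let `V` be an M-subspace of `b`
(`0 ∈ V`, `V` closed under `⊕`, `|V|² = 2ⁿ`, all second differences `D_u D_v b`, `u v ∈ V`, vanish). With
`V^⊥ = {y | ∀ s ∈ V, s·y = 0}`: the pair `(V, V^⊥)` is CLOSED for `b` (every slice row `k ↦ D_{e_k} D_s D_y b (0)`,
`s ∈ V`, lies in `V^⊥`, and for every `s ∈ V` the offset functional `r ↦ D_s D_r b (0)` on
`rad B_s = {r : D_s D_r b constant}` is the inner product with some `ℓ ∈ V^⊥`), the pair `(V^⊥, V)` is closed for `a`,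
and `V ⊥ V^⊥`.

Proof (`MPair.closed_of_flat`, one function `f` of degree `≤ 3` and a flat subspace `S`, target `U ⊇ S^⊥`):
* rows: `v · row(s, y) = D_v D_s D_y f (0)` (third differences of a cubic are base-point free and additive, hence
  represented by the row vector, `NoTrap.D3_repr`) `= D_y D_s D_v f (0) = 0` for `s v ∈ S` (flatness), so the row is in
  `S^⊥ ⊆ U`;
* offsets: `rad B_s` is a subspace containing `S` (cocycle law `NoTrap.D_bxor_left`), the offset `r ↦ D_s D_r f (0)` is
  additive on it and vanishes on `S`; an additive functional on a subspace `A` of `𝔽₂ⁿ` is an inner product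
  `r ↦ ℓ · r` (`MPair.exists_repr_of_additive`: if it is non-zero with kernel `K ⊊ A`, pick `ℓ ∈ K^⊥ ∖ A^⊥`, which exists
  as `K^⊥ ⊆ A^⊥` would give `A = A^⊥⊥ ⊆ K^⊥⊥ = K` by `NoTrap.perp_perp_eq`), and `ℓ · v = D_s D_v f (0) = 0` on `S` puts
  `ℓ` in `S^⊥ ⊆ U`.
The `b`-side is the case `S = V`, `U = V^⊥`; the `a`-side is `S = V^⊥`, `U = V`, using the landed frame lock
`stub_frameLock` (i) (`V^⊥` is an M-subspace of `a`) and `V^⊥⊥ = V` (`DerivativeWalsh.perp_perp_eq_of_sq`); orthogonality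
is the definition of `V^⊥`. No definitions; inner products are spelled `(univ.filter fun i => uᵢ ∧ zᵢ).card.bodd`.

References: C. Carlet, *Boolean Functions for Cryptography and Coding Theory*, CUP 2020, Prop. 54 (M-subspaces of
Maiorana–McFarland functions), Prop. 77 (duals), §2.2.2 (derivatives) [Carlet2020]; R. O'Donnell, *Analysis of Boolean
Functions*, CUP 2014, §3.3 (orthogonal complements in `𝔽₂ⁿ`) [ODonnell2014].
-/

noncomputable section

set_option linter.dupNamespace false -- D-0017: single-problem summit ⇒ `QuantumAdvantage.QuantumAdvantage` by design

namespace Summit.QuantumAdvantage.QuantumAdvantage.Theorems.SignedExactCubicForrelationNotPrBPP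

open Finset
open Literature.Computability.Complexity Literature.Computability.QuantumComplexity
open Literature.Computability.QuantumComplexity.BuzetChailloux (bxor zeroVec bxor_self bxor_comm
  bxor_zeroVec zeroVec_bxor)
open PolarGeometry (bdot_comm bdot_bxor_right twist_eq_one_iff_bdot bxor_bxor_swap bxor_bxor_assoc)
open NoTrap (bdot_zeroVec D_symm D_bxor_left D_zeroVec_eq D3_swap D3_repr perp_perp_eq)

namespace MPair

variable {n : ℕ}

/-! ### Additive functionals on a subspace of `𝔽₂ⁿ` -/

/-- **An additive functional on a subspace is an inner product.** If `A ∋ 0` is closed under `⊕` and `lam` is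
additive on `A`, then `lam r = ℓ · r` on `A` for some vector `ℓ`. Proof: if `lam` vanishes on `A` take `ℓ = 0`;
otherwise its kernel `K` is a proper subspace of `A`, and since `K^⊥ ⊆ A^⊥` would force `A = A^⊥⊥ ⊆ K^⊥⊥ = K`
(`NoTrap.perp_perp_eq`) there is `ℓ ∈ K^⊥` with `ℓ · r₁ = 1` for some `r₁ ∈ A`; then `lam r₁ = 1` and every `r ∈ A` is
in `K` or in `r₁ ⊕ K`. [cite: ODonnell2014, §3.3] -/
theorem exists_repr_of_additive {A : Finset (Fin n → Bool)} (h0 : zeroVec ∈ A)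
    (hadd : ∀ x ∈ A, ∀ y ∈ A, bxor x y ∈ A) (lam : (Fin n → Bool) → Bool)
    (hlam : ∀ x ∈ A, ∀ y ∈ A, lam (bxor x y) = (lam x ^^ lam y)) :
    ∃ ℓ : Fin n → Bool, ∀ r ∈ A, lam r = (univ.filter fun i => ℓ i && r i).card.bodd := by
  by_cases hall : ∀ r ∈ A, lam r = false
  · refine ⟨zeroVec, fun r hr => ?_⟩
    rw [hall r hr, bdot_comm, bdot_zeroVec]
  -- the kernel `K` of `lam` on `A`, a proper subspace of `A`
  set K : Finset (Fin n → Bool) := A.filter fun r => lam r = false with hK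
  have hlam0 : lam zeroVec = false := by
    have h := hlam zeroVec h0 zeroVec h0
    rw [bxor_self] at h
    revert h
    cases lam zeroVec <;> decide
  have hK0 : zeroVec ∈ K := mem_filter.2 ⟨h0, hlam0⟩
  have hKadd : ∀ x ∈ K, ∀ y ∈ K, bxor x y ∈ K := by
    intro x hx y hy
    obtain ⟨hxA, hxl⟩ := mem_filter.1 hx
    obtain ⟨hyA, hyl⟩ := mem_filter.1 hy
    refine mem_filter.2 ⟨hadd x hxA y hyA, ?_⟩
    rw [hlam x hxA y hyA, hxl, hyl]
    rfl
  -- some `ℓ ∈ K^⊥` pairs to `1` with some `r₁ ∈ A`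
  have key : ∃ ℓ : Fin n → Bool, ∃ r₁ ∈ A, (∀ k ∈ K, twist k ℓ = 1) ∧ twist r₁ ℓ ≠ 1 := by
    by_contra hne
    have hne' : ∀ ℓ : Fin n → Bool, (∀ k ∈ K, twist k ℓ = 1) → ∀ r ∈ A, twist r ℓ = 1 := by
      intro ℓ hℓ r hr
      by_contra h
      exact hne ⟨ℓ, r, hr, hℓ, h⟩
    have hsub : univ.filter (fun z => ∀ y ∈ (univ.filter fun y => ∀ x ∈ A, twist x y = 1), twist y z = 1) ⊆
        univ.filter (fun z => ∀ y ∈ (univ.filter fun y => ∀ x ∈ K, twist x y = 1), twist y z = 1) := by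
      intro z hz
      refine mem_filter.2 ⟨mem_univ _, fun y hy => (mem_filter.1 hz).2 y ?_⟩
      exact mem_filter.2 ⟨mem_univ _, hne' y (mem_filter.1 hy).2⟩
    rw [perp_perp_eq h0 hadd, perp_perp_eq hK0 hKadd] at hsub
    obtain ⟨r₀, hr₀A, hr₀⟩ : ∃ r₀ ∈ A, lam r₀ ≠ false := by
      by_contra h
      exact hall fun r hr => by
        by_contra h'
        exact h ⟨r, hr, h'⟩
    exact hr₀ (mem_filter.1 (hsub hr₀A)).2
  obtain ⟨ℓ, r₁, hr₁A, hℓK, hr₁ℓ⟩ := key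
  have hℓK' : ∀ k ∈ K, (univ.filter fun i => ℓ i && k i).card.bodd = false := fun k hk => by
    rw [bdot_comm]
    exact (twist_eq_one_iff_bdot k ℓ).1 (hℓK k hk)
  have hr₁ℓ' : (univ.filter fun i => ℓ i && r₁ i).card.bodd = true := by
    rw [bdot_comm]
    have h := (twist_eq_one_iff_bdot r₁ ℓ).not.1 hr₁ℓ
    revert h
    generalize (univ.filter fun i => r₁ i && ℓ i).card.bodd = c
    cases c <;> decide
  -- `r₁ ∉ K`, so `lam r₁ = 1`
  have hlr₁ : lam r₁ = true := by
    by_contra h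
    have h' : lam r₁ = false := by
      revert h
      cases lam r₁ <;> decide
    have h'' := hℓK' r₁ (mem_filter.2 ⟨hr₁A, h'⟩)
    rw [hr₁ℓ'] at h''
    exact Bool.noConfusion h''
  refine ⟨ℓ, fun r hr => ?_⟩
  cases hlr : lam r
  · exact (hℓK' r (mem_filter.2 ⟨hr, hlr⟩)).symm
  · have hK1 : bxor r r₁ ∈ K :=
      mem_filter.2 ⟨hadd r hr r₁ hr₁A, by rw [hlam r hr r₁ hr₁A, hlr, hlr₁]; rfl⟩
    have h := hℓK' (bxor r r₁) hK1
    rw [bdot_bxor_right, hr₁ℓ'] at h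
    revert h
    generalize (univ.filter fun i => ℓ i && r i).card.bodd = c
    cases c <;> decide

/-- The two spellings of `V^⊥` agree: `{y | ∀ v ∈ V, (-1)^{v·y} = 1} = {y | ∀ v ∈ V, v·y = 0}`. [folklore] -/
theorem perp_twist_eq_perp_bdot (V : Finset (Fin n → Bool)) :
    (univ.filter fun y => ∀ v ∈ V, twist v y = 1) =
      (Finset.univ.filter fun (y : Fin (n) → Bool) => ∀ s ∈ V, ((Finset.univ.filter fun i => s i && y i).card).bodd = false) :=
  Finset.filter_congr fun y _ => forall₂_congr fun v _ => twist_eq_one_iff_bdot v y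

/-! ### Flat subspaces give closed pairs -/

/-- **Flat subspaces give closed pairs.** Let `f` have degree `≤ 3`, let `S ∋ 0` be flat for `f` (all second
differences `D_u D_v f`, `u v ∈ S`, vanish identically) and let `U ⊇ S^⊥`. Then every slice row
`k ↦ D_{e_k} D_s D_y f (0)` (`s ∈ S`) lies in `U` — `v · row = D_v D_s D_y f (0) = D_y D_s D_v f (0) = 0` for `v ∈ S` by
`NoTrap.D3_repr`, `NoTrap.D3_swap` and flatness — and for every `s ∈ S` the offset `r ↦ D_s D_r f (0)` on
`rad B_s = {r : D_s D_r f constant}` (a subspace containing `S`, by the cocycle law) is additive, vanishes on `S`, and is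
therefore the inner product with some `ℓ ∈ S^⊥ ⊆ U` (`exists_repr_of_additive`). [cite: Carlet2020, §2.2.2] -/
theorem closed_of_flat {f : (Fin n → Bool) → Bool} (hf : IsDegLeFun 3 f)
    (D : (Fin n → Bool) → (Fin n → Bool) → (Fin n → Bool) → Bool)
    (hD : ∀ u v x, D u v x = (f x ^^ f (bxor x u) ^^ f (bxor x v) ^^ f (bxor x (bxor u v))))
    {S U : Finset (Fin n → Bool)} (hS0 : zeroVec ∈ S) (hflat : ∀ u ∈ S, ∀ v ∈ S, ∀ x, D u v x = false)
    (hU : ∀ y : Fin n → Bool, (∀ v ∈ S, (univ.filter fun i => v i && y i).card.bodd = false) → y ∈ U) :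
    (∀ s ∈ S, ∀ y : Fin n → Bool, (fun k => (D s y zeroVec ^^ D s y (fun j => decide (j = k)))) ∈ U) ∧
    (∀ s ∈ S, ∃ ℓ ∈ U, ∀ r : Fin n → Bool, (∀ y z : Fin n → Bool, (D s r z ^^ D s r (bxor z y)) = false) →
      (f r ^^ f (bxor r s) ^^ f zeroVec ^^ f s) = (univ.filter fun i => ℓ i && r i).card.bodd) := by
  constructor
  · -- rows
    intro s hs y
    apply hU
    intro v hv
    have h := D3_repr hf D hD s y v
    rw [D3_swap D hD s y v, hflat s hs v hv zeroVec, hflat s hs v hv y, bdot_comm] at h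
    exact h.symm
  · -- offsets
    intro s hs
    -- `rad B_s`, a subspace containing `S`
    set R : Finset (Fin n → Bool) := univ.filter fun r => ∀ y z : Fin n → Bool, (D s r z ^^ D s r (bxor z y)) = false
      with hR
    have hSR : ∀ v ∈ S, v ∈ R := fun v hv => mem_filter.2 ⟨mem_univ _, fun y z => by
      rw [hflat s hs v hv z, hflat s hs v hv (bxor z y)]
      rfl⟩
    have hsplit : ∀ r r' x, D s (bxor r r') x = (D s r (bxor x r') ^^ D s r' x) := fun r r' x => by
      rw [D_symm D hD s (bxor r r') x, D_bxor_left D hD r r' s x, D_symm D hD r s, D_symm D hD r' s]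
    have hRadd : ∀ r ∈ R, ∀ r' ∈ R, bxor r r' ∈ R := by
      intro r hr r' hr'
      refine mem_filter.2 ⟨mem_univ _, fun y z => ?_⟩
      have h1 := (mem_filter.1 hr).2 y (bxor z r')
      have h2 := (mem_filter.1 hr').2 y z
      rw [hsplit, hsplit, ← bxor_bxor_assoc z y r', bxor_bxor_swap z y r']
      revert h1 h2
      generalize D s r (bxor z r') = A
      generalize D s r (bxor (bxor z r') y) = B
      generalize D s r' z = C
      generalize D s r' (bxor z y) = E
      revert A B C E; decide
    -- the offset `r ↦ D_s D_r f (0)` is additive on `rad B_s`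
    have hlam : ∀ r ∈ R, ∀ r' ∈ R, D s (bxor r r') zeroVec = (D s r zeroVec ^^ D s r' zeroVec) := by
      intro r hr r' _
      have h1 := (mem_filter.1 hr).2 r' zeroVec
      rw [zeroVec_bxor] at h1
      rw [hsplit, zeroVec_bxor]
      revert h1
      generalize D s r zeroVec = A
      generalize D s r r' = B
      generalize D s r' zeroVec = C
      revert A B C; decide
    obtain ⟨ℓ, hℓ⟩ : ∃ ℓ : Fin n → Bool, ∀ r ∈ R, D s r zeroVec = (univ.filter fun i => ℓ i && r i).card.bodd :=
      exists_repr_of_additive (hSR zeroVec hS0) hRadd (fun r => D s r zeroVec) hlam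
    refine ⟨ℓ, hU ℓ fun v hv => ?_, fun r hr => ?_⟩
    · rw [bdot_comm, ← hℓ v (hSR v hv)]
      exact hflat s hs v hv zeroVec
    · rw [← D_zeroVec_eq D hD s r]
      exact hℓ r (mem_filter.2 ⟨mem_univ _, hr⟩)

end MPair

open MPair

/-- **M-pairs of an exact cubic pair are closed orthogonal pairs** (stub `stub_mpairClosed` of line
`dual-pingpong-frame`, crux stmt-QuantumAdvantage-13932; tree vocabulary = the line's `MSub`, `ClosedF`, `Orth` unfolded).
For `a`, `b` of degree `≤ 3` with `Φ(a, b) = ±1` and an M-subspace `V` of `b`: `(V, V^⊥)` is closed for `b`,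
`(V^⊥, V)` is closed for `a`, and `V ⊥ V^⊥`. The `b`-side is `MPair.closed_of_flat` with `S = V`, `U = V^⊥`; the
`a`-side is `MPair.closed_of_flat` with `S = V^⊥` (an M-subspace of `a` by the frame lock `stub_frameLock` (i)) and
`U = V = V^⊥⊥` (`DerivativeWalsh.perp_perp_eq_of_sq`); orthogonality is the definition of `V^⊥`.
[cite: Carlet2020, Prop. 77] -/
theorem stub_mpairClosed :
    ∀ (n : ℕ) (a b : (Fin n → Bool) → Bool) (V : Finset (Fin n → Bool)),
        IsDegLeFun 3 a → IsDegLeFun 3 b → (forrelation a b = 1 ∨ forrelation a b = -1) →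
        ((zeroVec ∈ V ∧ ∀ x ∈ V, ∀ y ∈ V, bxor x y ∈ V) ∧ (((V).card : ℝ) ^ 2 = (2 : ℝ) ^ (n)) ∧ ∀ u ∈ V, ∀ v ∈ V, ∀ x, (b x ^^ b (bxor x u) ^^ b (bxor x v) ^^ b (bxor x (bxor u v))) = false) →
        ((∀ s ∈ V, ∀ y : Fin (n) → Bool, (fun k => (b zeroVec ^^ b (bxor zeroVec s) ^^ b (bxor zeroVec y) ^^ b (bxor zeroVec (bxor s y))) ^^ (b (fun j => decide (j = k)) ^^ b (bxor (fun j => decide (j = k)) s) ^^ b (bxor (fun j => decide (j = k)) y) ^^ b (bxor (fun j => decide (j = k)) (bxor s y)))) ∈ (Finset.univ.filter fun (y : Fin (n) → Bool) => ∀ s ∈ V, ((Finset.univ.filter fun i => s i && y i).card).bodd = false)) ∧ (∀ s ∈ V, ∃ ℓ ∈ (Finset.univ.filter fun (y : Fin (n) → Bool) => ∀ s ∈ V, ((Finset.univ.filter fun i => s i && y i).card).bodd = false), ∀ r : Fin (n) → Bool, (∀ y z : Fin (n) → Bool, ((b z ^^ b (bxor z s) ^^ b (bxor z r) ^^ b (bxor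 z (bxor s r))) ^^ (b (bxor z y) ^^ b (bxor (bxor z y) s) ^^ b (bxor (bxor z y) r) ^^ b (bxor (bxor z y) (bxor s r)))) = false) → (b r ^^ b (bxor r s) ^^ b zeroVec ^^ b s) = ((Finset.univ.filter fun i => ℓ i && r i).card).bodd)) ∧
        ((∀ s ∈ (Finset.univ.filter fun (y : Fin (n) → Bool) => ∀ s ∈ V, ((Finset.univ.filter fun i => s i && y i).card).bodd = false), ∀ y : Fin (n) → Bool, (fun k => (a zeroVec ^^ a (bxor zeroVec s) ^^ a (bxor zeroVec y) ^^ a (bxor zeroVec (bxor s y))) ^^ (a (fun j => decide (j = k)) ^^ a (bxor (fun j => decide (j = k)) s) ^^ a (bxor (fun j => decide (j = k)) y) ^^ a (bxor (fun j => decide (j = k)) (bxor s y)))) ∈ V) ∧ (∀ s ∈ (Finset.univ.filter fun (y : Fin (n) → Bool) => ∀ s ∈ V, ((Finset.univ.filter fun i => s i && y i).card).bodd = false), ∃ ℓ ∈ V, ∀ r : Fin (n) → Bool, (∀ y z : Fin (n) → Bool, ((a z ^^ a (bxor z s) ^^ a (bxor z r) ^^ a (bxor z (bxor s r))) ^^ (a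 (bxor z y) ^^ a (bxor (bxor z y) s) ^^ a (bxor (bxor z y) r) ^^ a (bxor (bxor z y) (bxor s r)))) = false) → (a r ^^ a (bxor r s) ^^ a zeroVec ^^ a s) = ((Finset.univ.filter fun i => ℓ i && r i).card).bodd)) ∧
        (∀ s ∈ V, ∀ u ∈ (Finset.univ.filter fun (y : Fin (n) → Bool) => ∀ s ∈ V, ((Finset.univ.filter fun i => s i && y i).card).bodd = false), ((Finset.univ.filter fun i => s i && u i).card).bodd = false) := by
  intro n a b V ha hb hΦ hV
  -- name the second differences of `b` and `a`
  obtain ⟨Db, hDb⟩ : ∃ D : (Fin n → Bool) → (Fin n → Bool) → (Fin n → Bool) → Bool,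
      ∀ u v x, D u v x = (b x ^^ b (bxor x u) ^^ b (bxor x v) ^^ b (bxor x (bxor u v))) := ⟨_, fun _ _ _ => rfl⟩
  obtain ⟨Da, hDa⟩ : ∃ D : (Fin n → Bool) → (Fin n → Bool) → (Fin n → Bool) → Bool,
      ∀ u v x, D u v x = (a x ^^ a (bxor x u) ^^ a (bxor x v) ^^ a (bxor x (bxor u v))) := ⟨_, fun _ _ _ => rfl⟩
  -- frame lock (i): `V^⊥` is an M-subspace of `a`; and `V^⊥⊥ = V`
  have hFL := stub_frameLock n a b V hΦ hV
  rw [perp_twist_eq_perp_bdot V] at hFL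
  obtain ⟨⟨⟨hP0, -⟩, -, hMa⟩, -, -⟩ := hFL
  obtain ⟨⟨h0, hadd⟩, hcard, hM⟩ := hV
  have hPP := (DerivativeWalsh.perp_perp_eq_of_sq h0 hadd hcard).1
  rw [perp_twist_eq_perp_bdot V] at hPP
  simp only [← hDb] at hM ⊢
  simp only [← hDa] at hMa ⊢
  refine ⟨closed_of_flat hb Db hDb h0 hM (fun y hy => mem_filter.2 ⟨mem_univ _, hy⟩),
    closed_of_flat ha Da hDa hP0 hMa (fun y hy => (Finset.ext_iff.1 hPP y).1
      (mem_filter.2 ⟨mem_univ _, fun v hv => (twist_eq_one_iff_bdot v y).2 (hy v hv)⟩)),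
    fun s hs u hu => (mem_filter.1 hu).2 s hs⟩

end Summit.QuantumAdvantage.QuantumAdvantage.Theorems.SignedExactCubicForrelationNotPrBPP

end
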